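import Summits.QuantumAdvantage.QuantumAdvantage.Theorems.LinnikCubicClassGroupsDegreeOnePrimesEscapeClassPNTDHLinnik
import Literature.NumberTheory.LFunctions.UniformClassGroupPNTTransferMain
import Literature.NumberTheory.LFunctions.UniformClassGroupPNTTransfer
import HarnessLib

/-!
# The class prime number theorem with the Deuring–Heilbronn phenomenon, VII: the `π_C`-form with
# relative error

Topic `Summits/QuantumAdvantage/QuantumAdvantage/Theorems`, cell B2b-1 (linnik-cubic), PART A (gen 4);
helper toward the crux `DegreeOnePrimesEscape` (stmt-QuantumAdvantage-11543) of route
`LinnikCubicClassGroups`.  HONEST FRAMING: the value of this file is a THEOREM (kernel-checked,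
GRH-free) — NOT summit progress (the route still rests on the hypothesis-type target
`PureCubicClassNumberHard`).

`classPNT_relative_of_zeroRepulsion`: GIVEN the Deuring–Heilbronn phenomenon (hypothesis `hDH`, the
statement of `Literature.NumberTheory.LFunctions.NumberField.deuringHeilbronn` verbatim), Thorner–Zaman's
Theorem 1.4 for the Hilbert class field in `π_C`-form: for `n > 1` and `ε > 0` there is `a₃` such that for
every number field `K` of degree `n` and all `x ≥ Q^{a₃}` (`Q = |d_K|·nⁿ`, `h = h_K`), EITHER
`|π_C(x) − Li(x)/h| ≤ ε Li(x)/h` for every class `C`, OR (one real class group character `χ₁` with a real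
zero `β₁`) `|π_C(x) − G_C(x)/h| ≤ ε G_C(x)/h` with `G_C(x) = Li(x) − χ₁(C) Li(x^{β₁}) > 0`, for every `C`.
Ingredients: the relative `θ_C`-form `thetaClass_relative_of_zeroRepulsion` (file V), the tree's
relative-error partial summation `abs_sub_exceptionalLiMain_le`, and the lower bound
`G_C(x) ≥ (x − x^{β₁}/β₁)/log x ≥ x·min(1,(1−β₁)log x)/(4 log x) ≥ c₁(n) x Q^{−2}/(4 log x)`
(`sub_rpow_div_log_le_offsetLogIntegral_sub`, `sub_mul_rpow_div_ge`, Stark's effective bound).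

References: J. Thorner, A. Zaman, Algebra Number Theory 13 (2019), Thm. 1.4 and §5 [ThornerZaman2019];
A. Weiss, J. reine angew. Math. 338 (1983), Thm. 5.2 [Weiss1983].
-/

noncomputable section

open Complex Real MeasureTheory Set Filter Topology
open scoped NumberField nonZeroDivisors

namespace Summit.QuantumAdvantage.QuantumAdvantage.Theorems.DegreeOnePrimesEscape

open Literature.NumberTheory.LFunctions Literature.NumberTheory.LFunctions.NumberField
  Literature.NumberTheory.LFunctions.AbelianDensity

set_option maxHeartbeats 1600000 in
/-- **The class prime number theorem in `π_C`-form with RELATIVE error in the Linnik range, given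
Deuring–Heilbronn** (see the module docstring). [cite: ThornerZaman2019, Theorem 1.4]
[cite: Weiss1983, Theorem 5.2] -/
theorem classPNT_relative_of_zeroRepulsion
    (hDH : ∃ C : ℝ, 0 < C ∧ ∀ (K : Type) [Field K] [NumberField K] (χ₁ : ClassGroup (𝓞 K) →* ℂˣ),
      χ₁ * χ₁ = 1 → ∀ β₁ : ℝ, 0 < β₁ → β₁ < 1 → classGroupLFunction K χ₁ β₁ = 0 →
      ∀ (χ : ClassGroup (𝓞 K) →* ℂˣ) (ρ : ℂ), classGroupLFunction K χ ρ = 0 → 1 / 2 ≤ ρ.re → ρ ≠ 1 →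
        ρ ≠ β₁ →
        Real.log (1 / (C * (Real.log ((NumberField.discr K).natAbs : ℝ) +
            Module.finrank ℚ K * (Real.log (|ρ.im| + 2) + 1)) * (1 - β₁))) /
          (C * (Real.log ((NumberField.discr K).natAbs : ℝ) +
            Module.finrank ℚ K * (Real.log (|ρ.im| + 2) + 1))) ≤ 1 - ρ.re)
    (n : ℕ) (hn : 1 < n) {ε : ℝ} (hε : 0 < ε) :
    ∃ a₃ c : ℝ, 1 ≤ a₃ ∧ 0 < c ∧ c ≤ 1 / (8 * ((n : ℝ) ^ 2 + 1)) ∧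
    ∀ (K : Type) [Field K] [NumberField K], Module.finrank ℚ K = n →
      (∀ x : ℝ, ThornerZaman.condQn K ^ a₃ ≤ x → ∀ C : ClassGroup (𝓞 K),
          |(primeIdealClassCount K C x : ℝ) - offsetLogIntegral x / NumberField.classNumber K| ≤
            ε * offsetLogIntegral x / NumberField.classNumber K) ∨
      ∃ (χ₁ : ClassGroup (𝓞 K) →* ℂˣ) (β₁ : ℝ), χ₁ * χ₁ = 1 ∧
          1 - c / (Real.log ((NumberField.discr K).natAbs : ℝ) + Real.log 4) < β₁ ∧ β₁ < 1 ∧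
          classGroupLFunction K χ₁ β₁ = 0 ∧
          ∀ x : ℝ, ThornerZaman.condQn K ^ a₃ ≤ x → ∀ C : ClassGroup (𝓞 K),
            0 < offsetLogIntegral x - ((χ₁ C : ℂ)).re * offsetLogIntegral (x ^ β₁) ∧
            |(primeIdealClassCount K C x : ℝ) -
                (offsetLogIntegral x - ((χ₁ C : ℂ)).re * offsetLogIntegral (x ^ β₁)) /
                  NumberField.classNumber K| ≤
              ε * (offsetLogIntegral x - ((χ₁ C : ℂ)).re * offsetLogIntegral (x ^ β₁)) /
                NumberField.classNumber K := by
  classical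
  have hε60 : 0 < ε / 60 := by positivity
  obtain ⟨a₂, c, ha₂1, hc, hcn, hθ⟩ := thetaClass_relative_of_zeroRepulsion hDH n hn hε60
  obtain ⟨c₁, hc₁, hc₁1, heff⟩ := Residue.one_sub_realZero_ge_condQn_rpow n hn
  have hn2 : (2 : ℝ) ≤ n := by exact_mod_cast hn
  set Λ : ℝ := max 0 (Real.log (640 / (ε * c₁))) with hΛ
  have hΛ0 : 0 ≤ Λ := le_max_left _ _
  set a₃ : ℝ := max (max (2 * a₂) 28) (28 + 4 * Λ) with ha₃
  have ha₃a₂ : 2 * a₂ ≤ a₃ := le_trans (le_max_left _ _) (le_max_left _ _)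
  have ha₃28 : (28 : ℝ) ≤ a₃ := le_trans (le_max_right _ _) (le_max_left _ _)
  have ha₃Λ : 28 + 4 * Λ ≤ a₃ := le_max_right _ _
  refine ⟨a₃, c, by linarith, hc, hcn, fun K _ _ hKn ↦ ?_⟩
  have hK : 1 < Module.finrank ℚ K := by rw [hKn]; exact hn
  set Q : ℝ := ThornerZaman.condQn K with hQ
  have hQ12 : (12 : ℝ) ≤ Q := ThornerZaman.twelve_le_condQn (K := K) hK
  have hQ1 : (1 : ℝ) < Q := by linarith
  have hQ0 : (0 : ℝ) < Q := by linarith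
  have hQne : Q ≠ 0 := hQ0.ne'
  have hlogQ : 2 ≤ Real.log Q := two_lt_log_twelve.le.trans (Real.log_le_log (by norm_num) hQ12)
  set h : ℝ := (NumberField.classNumber K : ℝ) with hh
  have hh1 : 1 ≤ h := by rw [hh]; exact_mod_cast one_le_classNumber (K := K)
  have hh0 : 0 < h := by linarith
  have hhQ : h ≤ Q ^ 4 := by
    have := ThornerZaman.classNumber_le_condQn_pow (K := K) hK; rw [← hQ] at this; exact this
  have hnQ : (n : ℝ) ≤ Q := by
    have := ThornerZaman.finrank_le_condQn (K := K); rw [hKn] at this; exact this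
  have hQm2' : 0 < Q ^ (-(2 : ℝ)) := Real.rpow_pos_of_pos hQ0 _
  have hQm2 : Q ^ (-(2 : ℝ)) ≤ 1 := Real.rpow_le_one_of_one_le_of_nonpos hQ1.le (by norm_num)
  set m' : ℝ := c₁ * Q ^ (-(2 : ℝ)) with hm'
  have hm'0 : 0 < m' := mul_pos hc₁ hQm2'
  have hm'1 : m' ≤ 1 := (mul_le_mul hc₁1 hQm2 hQm2'.le zero_le_one).trans (by norm_num)
  have hm'2 : m' = c₁ * (Q ^ 2)⁻¹ := by rw [hm', Real.rpow_neg hQ0.le, Real.rpow_two]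
  -- Chebyshev: `θ_C(t) ≤ θ_K(t) ≤ B t`
  set B : ℝ := (n : ℝ) * (Real.log 4 + 4) with hBdef
  have hlog40 : 0 ≤ Real.log 4 := Real.log_nonneg (by norm_num)
  have hB0 : 0 ≤ B := by positivity
  have hB6 : B ≤ 6 * Q := by
    have hlog4 : Real.log 4 < 2 := by
      have : Real.log 4 = 2 * Real.log 2 := by
        rw [show (4:ℝ) = 2 ^ 2 by norm_num, Real.log_pow]; norm_num
      rw [this]; have := Real.log_two_lt_d9; linarith
    have hn0 : (0:ℝ) ≤ n := Nat.cast_nonneg _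
    have : (n : ℝ) * (Real.log 4 + 4) ≤ n * 6 := mul_le_mul_of_nonneg_left (by linarith) hn0
    rw [hBdef]; nlinarith
  -- sizes at `x ≥ Q^{a₃}` and the junk inequality
  set y : ℝ := Q ^ a₂ with hy
  have hy1 : 1 ≤ y := Real.one_le_rpow hQ1.le (by linarith)
  have hy2 : 2 ≤ y := by
    have := Real.rpow_le_rpow_of_exponent_le hQ1.le ha₂1
    rw [Real.rpow_one] at this; rw [hy]; linarith
  have hnum : ∀ x : ℝ, Q ^ a₃ ≤ x → 256 ≤ x ∧ y ^ 2 ≤ x ∧ 16 ≤ Real.log x ∧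
      (∀ G : ℝ, x * m' / (4 * h * Real.log x) ≤ G / h → (3 * B + 19 / h) * Real.sqrt x ≤ ε / 2 * (G / h)) := by
    intro x hx
    have hxQ : Q ≤ x := by
      have := Real.rpow_le_rpow_of_exponent_le hQ1.le (show (1:ℝ) ≤ a₃ by linarith)
      rw [Real.rpow_one] at this; exact this.trans hx
    have hx1 : 1 < x := by linarith
    have hx0 : 0 < x := by linarith
    have hLx : a₃ * Real.log Q ≤ Real.log x := by
      have := Real.log_le_log (by positivity) hx
      rwa [Real.log_rpow hQ0] at this
    have hL16 : 16 ≤ Real.log x := by nlinarith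
    have hlogx0 : 0 < Real.log x := by linarith
    -- `x ≥ 256`: `log x ≥ 16 > log 256`
    have hx256 : (256 : ℝ) ≤ x := by
      by_contra hlt
      rw [not_le] at hlt
      have h1 : Real.log x < Real.log 256 := Real.log_lt_log hx0 hlt
      have h2 : Real.log 256 ≤ 256 - 1 := Real.log_le_sub_one_of_pos (by norm_num)
      have h3 : Real.log (256 : ℝ) = 8 * Real.log 2 := by
        rw [show (256 : ℝ) = 2 ^ 8 by norm_num, Real.log_pow]; norm_num
      have := Real.log_two_lt_d9
      linarith
    have hy2x : y ^ 2 ≤ x := by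
      rw [hy, ← Real.rpow_natCast, ← Real.rpow_mul hQ0.le]
      refine le_trans (Real.rpow_le_rpow_of_exponent_le hQ1.le ?_) hx
      push_cast; linarith
    refine ⟨hx256, hy2x, hL16, fun G hG ↦ ?_⟩
    -- `u = x^{1/4}`: `√x = u²`, `x = u⁴`, `log x ≤ 4u`, and `640 Q⁷/(ε c₁) ≤ u`
    set u : ℝ := x ^ ((1 : ℝ) / 4) with hu
    have hu0 : 0 < u := Real.rpow_pos_of_pos hx0 _
    have hsx : Real.sqrt x = u ^ 2 := by
      rw [Real.sqrt_eq_rpow, hu, ← Real.rpow_natCast, ← Real.rpow_mul hx0.le]; norm_num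
    have hx4 : x = u ^ 4 := by
      rw [hu, ← Real.rpow_natCast, ← Real.rpow_mul hx0.le]; norm_num
    have hlogu : Real.log x ≤ 4 * u := by
      have h1 : Real.log x = 4 * Real.log u := by
        rw [hu, Real.log_rpow hx0]; ring
      have h2 := Real.log_le_sub_one_of_pos hu0
      linarith
    have hth := mul_rpow_neg_le_one_of_threshold (k := 7) (M := 640 / (ε * c₁)) (ν := 1 / 4) hQ12 hx
      (by norm_num) (by positivity) (by rw [← hΛ]; linarith)
    have hQ7 : Q ^ (7 : ℝ) = Q ^ 7 := by norm_cast
    have huinv : x ^ (-(1 / 4 : ℝ)) = u⁻¹ := by rw [hu, Real.rpow_neg hx0.le]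
    rw [hQ7, huinv] at hth
    have hMu : 640 / (ε * c₁) * Q ^ 7 ≤ u := by
      have := mul_le_mul_of_nonneg_right hth hu0.le
      rwa [mul_assoc, inv_mul_cancel₀ hu0.ne', mul_one, one_mul] at this
    have hkey : 640 * Q ^ 7 ≤ ε * c₁ * u := by
      have := mul_le_mul_of_nonneg_left hMu (by positivity : (0 : ℝ) ≤ ε * c₁)
      have e : ε * c₁ * (640 / (ε * c₁) * Q ^ 7) = 640 * Q ^ 7 := by field_simp
      linarith
    -- `(3B + 19/h)√x ≤ 20 Q u²`
    have hJ : (3 * B + 19 / h) * Real.sqrt x ≤ 20 * Q * u ^ 2 := by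
      rw [hsx]
      have h19 : 19 / h ≤ 19 := by rw [div_le_iff₀ hh0]; nlinarith
      have : 3 * B + 19 / h ≤ 20 * Q := by linarith
      exact mul_le_mul_of_nonneg_right this (by positivity)
    -- `20 Q u² ≤ (ε/2) · x m'/(4 h log x)`
    have hden : 0 < 4 * h * Real.log x := by positivity
    have hR : 20 * Q * u ^ 2 ≤ ε / 2 * (x * m' / (4 * h * Real.log x)) := by
      rw [show ε / 2 * (x * m' / (4 * h * Real.log x)) = ε / 2 * (x * m') / (4 * h * Real.log x) by ring,
        le_div_iff₀ hden]
      -- `20 Q u² (4 h log x) ≤ 320 Q⁵ u³ ≤ (ε/2) u⁴ c₁ / Q² = (ε/2) x m'`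
      have h1 : 20 * Q * u ^ 2 * (4 * h * Real.log x) ≤ 20 * Q * u ^ 2 * (4 * Q ^ 4 * (4 * u)) := by
        refine mul_le_mul_of_nonneg_left ?_ (by positivity)
        exact mul_le_mul (mul_le_mul_of_nonneg_left hhQ (by norm_num)) hlogu hlogx0.le (by positivity)
      have h2 : 20 * Q * u ^ 2 * (4 * Q ^ 4 * (4 * u)) = 320 * Q ^ 5 * u ^ 3 := by ring
      have h3 : 320 * Q ^ 5 * u ^ 3 ≤ ε / 2 * (x * m') := by
        rw [hx4, hm'2]
        have e : ε / 2 * (u ^ 4 * (c₁ * (Q ^ 2)⁻¹)) = (ε * c₁ * u) * u ^ 3 / (2 * Q ^ 2) := by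
          field_simp
        rw [e, le_div_iff₀ (by positivity)]
        have h4 := mul_le_mul_of_nonneg_right hkey (by positivity : (0 : ℝ) ≤ u ^ 3)
        have e2 : 320 * Q ^ 5 * u ^ 3 * (2 * Q ^ 2) = 640 * Q ^ 7 * u ^ 3 := by ring
        rw [e2]; exact h4
      linarith
    calc (3 * B + 19 / h) * Real.sqrt x ≤ 20 * Q * u ^ 2 := hJ
      _ ≤ ε / 2 * (x * m' / (4 * h * Real.log x)) := hR
      _ ≤ ε / 2 * (G / h) := mul_le_mul_of_nonneg_left hG (by positivity)
  -- Chebyshev bound and integrability for `θ_C`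
  have hTB : ∀ (C : ClassGroup (𝓞 K)) (t : ℝ), 2 ≤ t → chebyshevThetaIdealClass K C t ≤ B * t := by
    intro C t ht
    have := chebyshevThetaIdeal_le_mul (K := K) (x := t) (by linarith)
    rw [hKn] at this
    exact (chebyshevThetaIdealClass_le_chebyshevThetaIdeal C t).trans (by rw [hBdef]; linarith)
  rcases hθ K hKn with hgood | ⟨χ₁, β₁, hreal, hβlow, hβ1, hLz, hexc⟩
  · -- no exceptional zero: `G = Li(x)`
    left
    intro x hx C
    obtain ⟨hx256, hy2x, hL16, hjunk⟩ := hnum x hx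
    have hx2 : (2 : ℝ) ≤ x := by linarith
    have hx1 : (1 : ℝ) < x := by linarith
    have hx0 : 0 < x := by linarith
    have hlogx0 : 0 < Real.log x := Real.log_pos hx1
    have hTint : IntervalIntegrable (fun t ↦ chebyshevThetaIdealClass K C t / (t * Real.log t ^ 2))
        volume 2 x := by
      rw [intervalIntegrable_iff_integrableOn_Icc_of_le hx2]
      exact integrableOn_chebyshevThetaIdealClass_div K C x
    have key := abs_sub_exceptionalLiMain_le (T := chebyshevThetaIdealClass K C) (E := fun _ ↦ (1 : ℝ))
      (P := (primeIdealClassCount K C x : ℝ)) (θ₁ := 0) (β := 1) (A := ε / 60) (B := B) (y := y)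
      hh0 (by simp) (by norm_num) le_rfl hε60.le hB0 hy2
      (fun t _ ↦ chebyshevThetaIdealClass_nonneg C t) (hTB C) (antitoneOn_const) (fun _ _ ↦ zero_le_one)
      (fun t ht ↦ by
        have h1 := hgood t (by rw [← hQ]; exact ht) C
        have e : t - 0 * t ^ (1 : ℝ) / 1 = t := by simp
        rw [e]
        calc |chebyshevThetaIdealClass K C t - t / h| ≤ ε / 60 * t / h := h1
          _ = ε / 60 * 1 * (t / h) := by ring)
      hx256 hy2x hTint (primeIdealClassCount_eq_theta_div_log_add_integral K C hx2)
    simp only [zero_mul, sub_zero, mul_one] at key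
    -- lower bound `Li(x)/h ≥ x m'/(4 h log x)`
    have hLi : x * m' / (4 * h * Real.log x) ≤ offsetLogIntegral x / h := by
      have h1 := sub_mul_inv_log_pow_le_offsetLogIntegralPow 1 hx2
      rw [pow_one, offsetLogIntegralPow_one] at h1
      -- `(x - 2)/log x ≥ x/(2 log x) ≥ x m'/(4 log x)`
      have h2 : x * m' / (4 * Real.log x) ≤ (x - 2) * (Real.log x)⁻¹ := by
        rw [div_le_iff₀ (by positivity)]
        have : x * m' ≤ x * 1 := mul_le_mul_of_nonneg_left hm'1 hx0.le
        have e : (x - 2) * (Real.log x)⁻¹ * (4 * Real.log x) = 4 * (x - 2) := by field_simp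
        rw [e]; nlinarith
      have h3 : x * m' / (4 * h * Real.log x) = (x * m' / (4 * Real.log x)) / h := by
        field_simp
      rw [h3]
      exact div_le_div_of_nonneg_right (h2.trans h1) hh0.le
    have hJ := hjunk (offsetLogIntegral x) hLi
    have e30 : 30 * (ε / 60) * (offsetLogIntegral x / h) = ε / 2 * (offsetLogIntegral x / h) := by ring
    rw [e30] at key
    have : |(primeIdealClassCount K C x : ℝ) - offsetLogIntegral x / h| ≤ ε * (offsetLogIntegral x / h) := by
      linarith
    simpa [mul_div_assoc] using this
  · -- the exceptional zero
    right
    have hβ34 : 3 / 4 ≤ β₁ := by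
      have hlog4 : 1 < Real.log 4 := by
        rw [show (4:ℝ) = 2 ^ 2 by norm_num, Real.log_pow]; have := Real.log_two_gt_d9; push_cast; linarith
      have hlogd : 0 ≤ Real.log ((NumberField.discr K).natAbs : ℝ) := Real.log_natCast_nonneg _
      have hc4 : c ≤ 1 / 4 := by
        refine hcn.trans ?_
        rw [div_le_div_iff_of_pos_left one_pos (by positivity) (by norm_num)]
        have := sq_nonneg (n : ℝ); linarith
      have : c / (Real.log ((NumberField.discr K).natAbs : ℝ) + Real.log 4) ≤ 1 / 4 := by
        rw [div_le_iff₀ (by linarith)]; linarith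
      linarith
    have hβhalf : 1 / 2 < β₁ := by linarith
    refine ⟨χ₁, β₁, hreal, hβlow, hβ1, hLz, fun x hx C ↦ ?_⟩
    obtain ⟨hx256, hy2x, hL16, hjunk⟩ := hnum x hx
    have hx2 : (2 : ℝ) ≤ x := by linarith
    have hx1 : (1 : ℝ) < x := by linarith
    have hx0 : 0 < x := by linarith
    have hlogx0 : 0 < Real.log x := Real.log_pos hx1
    have hlogx1 : 1 ≤ Real.log x := by linarith
    set r : ℝ := ((χ₁ C : ℂ)).re with hr
    have hrabs : |r| ≤ 1 := abs_re_classGroupChar_apply_le hreal C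
    have hTint : IntervalIntegrable (fun t ↦ chebyshevThetaIdealClass K C t / (t * Real.log t ^ 2))
        volume 2 x := by
      rw [intervalIntegrable_iff_integrableOn_Icc_of_le hx2]
      exact integrableOn_chebyshevThetaIdealClass_div K C x
    have key := abs_sub_exceptionalLiMain_le (T := chebyshevThetaIdealClass K C) (E := fun _ ↦ (1 : ℝ))
      (P := (primeIdealClassCount K C x : ℝ)) (θ₁ := r) (β := β₁) (A := ε / 60) (B := B) (y := y)
      hh0 hrabs hβhalf hβ1.le hε60.le hB0 hy2
      (fun t _ ↦ chebyshevThetaIdealClass_nonneg C t) (hTB C) (antitoneOn_const) (fun _ _ ↦ zero_le_one)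
      (fun t ht ↦ by
        have h1 := (hexc t (by rw [← hQ]; exact ht) C).2
        calc |chebyshevThetaIdealClass K C t - (t - r * t ^ β₁ / β₁) / h| ≤
            ε / 60 * (t - r * t ^ β₁ / β₁) / h := h1
          _ = ε / 60 * 1 * ((t - r * t ^ β₁ / β₁) / h) := by ring)
      hx256 hy2x hTint (primeIdealClassCount_eq_theta_div_log_add_integral K C hx2)
    set G : ℝ := offsetLogIntegral x - r * offsetLogIntegral (x ^ β₁) with hG
    -- lower bound `G/h ≥ x m'/(4 h log x)`
    have hδ : m' ≤ 1 - β₁ := heff K hKn χ₁ hreal β₁ hβ1 hLz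
    have hGlow : x * m' / (4 * h * Real.log x) ≤ G / h := by
      have hLiβ : 0 ≤ offsetLogIntegral (x ^ β₁) := by
        have hxβ2 : (2 : ℝ) ≤ x ^ β₁ := by
          have : x ^ ((1 : ℝ) / 2) ≤ x ^ β₁ := Real.rpow_le_rpow_of_exponent_le hx1.le (by linarith)
          have h16 : (16 : ℝ) ≤ x ^ ((1 : ℝ) / 2) := by
            rw [← Real.sqrt_eq_rpow, show (16 : ℝ) = Real.sqrt 256 by
              rw [show (256 : ℝ) = 16 ^ 2 by norm_num, Real.sqrt_sq (by norm_num)]]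
            exact Real.sqrt_le_sqrt hx256
          linarith
        have h0 := offsetLogIntegralPow_nonneg 1 hxβ2
        rwa [offsetLogIntegralPow_one] at h0
      have h1 : offsetLogIntegral x - offsetLogIntegral (x ^ β₁) ≤ G := by
        rw [hG]
        have : r * offsetLogIntegral (x ^ β₁) ≤ 1 * offsetLogIntegral (x ^ β₁) :=
          mul_le_mul_of_nonneg_right (abs_le.1 hrabs).2 hLiβ
        linarith
      have h2 := sub_rpow_div_log_le_offsetLogIntegral_sub hx1 (by linarith : 0 < β₁) hβ1.le
      have h3 : x - x ^ β₁ / β₁ ≤ x - x ^ β₁ := by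
        have hxβ0 : 0 < x ^ β₁ := Real.rpow_pos_of_pos hx0 _
        have : x ^ β₁ ≤ x ^ β₁ / β₁ := by
          rw [le_div_iff₀ (by linarith)]; nlinarith
        exact sub_le_sub_left this x
      have h4 := sub_mul_rpow_div_ge hx1 hL16 hβ34 hβ1 (show |(1 : ℝ)| ≤ 1 by simp)
      rw [one_mul] at h4
      have hmin : m' ≤ min 1 ((1 - β₁) * Real.log x) := by
        refine le_min hm'1 (hδ.trans ?_)
        have := mul_le_mul_of_nonneg_left hlogx1 (by linarith : (0 : ℝ) ≤ 1 - β₁); linarith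
      have h5 : x * m' / 4 ≤ x - x ^ β₁ := by
        have := mul_le_mul_of_nonneg_left hmin (by positivity : (0 : ℝ) ≤ x / 4)
        linarith
      have h6 : x * m' / (4 * Real.log x) ≤ (x - x ^ β₁) / Real.log x := by
        rw [show x * m' / (4 * Real.log x) = (x * m' / 4) / Real.log x by field_simp]
        exact div_le_div_of_nonneg_right h5 hlogx0.le
      have h7 : x * m' / (4 * h * Real.log x) = (x * m' / (4 * Real.log x)) / h := by field_simp
      rw [h7]
      exact div_le_div_of_nonneg_right ((h6.trans h2).trans h1) hh0.le
    have hG0 : 0 < G := by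
      have : 0 < x * m' / (4 * h * Real.log x) := by positivity
      have := this.trans_le hGlow
      exact (div_pos_iff_of_pos_right hh0).1 this
    have hJ := hjunk G hGlow
    refine ⟨hG0, ?_⟩
    have e30 : 30 * (ε / 60) * 1 * (G / h) = ε / 2 * (G / h) := by ring
    rw [e30] at key
    have : |(primeIdealClassCount K C x : ℝ) - G / h| ≤ ε * (G / h) := by linarith
    simpa [hG, mul_div_assoc] using this

end Summit.QuantumAdvantage.QuantumAdvantage.Theorems.DegreeOnePrimesEscape

end
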